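import Mathlib.FieldTheory.IsAlgClosed.AlgebraicClosure
import Mathlib.FieldTheory.AlgebraicClosure
import Mathlib.FieldTheory.IntermediateField.Adjoin.Algebra
import Mathlib.RingTheory.AlgebraicIndependent.Adjoin
import Mathlib.RingTheory.AlgebraicIndependent.TranscendenceBasis
import Mathlib.RingTheory.AlgebraicIndependent.Transcendental
import Mathlib.Algebra.Module.Torsion.Field
import Mathlib.Algebra.Algebra.Hom.Rat
import Mathlib.Analysis.SpecialFunctions.Complex.Log
import Mathlib.Analysis.Complex.Polynomial.Basic
import Literature.NumberTheory.Transcendental.ExpVarietiesDimension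
import Literature.NumberTheory.Transcendental.ExpPointsExamples
import Literature.NumberTheory.Transcendental.RoyCriterion
import HarnessLib

/-!
# Transcendence degree of a point vs. dimension of a ℚ-variety through it; SC(2) ⇒ SPARSITY(2)

For `W ⊆ ℂ^ι` defined over the prime field (`IsDefinedOver ⊥ W`, `ExpVarieties.lean`) and a point
`P ∈ W`:

* `trdeg_adjoin_lt_of_mem_of_zariskiDim_lt` — `zariskiDim ℂ W < d ⇒ trdeg_ℚ ℚ(P) < d`
  ("a point of a ℚ-variety of dimension `≤ k` has transcendence degree `≤ k`").

Consequences for the Schanuel routes (`indepExpPoints`, `ExpPointsExamples.lean`):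

* `indepExpPoints_eq_empty_of_schanuelRank_two` — `SchanuelRank 2` (Roy's format of Schanuel's
  conjecture at `n = 2`, `RoyCriterion.lean`) empties `indepExpPoints W` for every ℚ-defined
  `W ⊆ ℂ² × ℂ²` with `zariskiDim ℂ W < 2`; hence `sparsity_of_schanuelRank_two`: SC(2) implies
  SPARSITY(2) (the crux `SparsityTwo`), which therefore admits no unconditional refutation.

## Proof

Avoiding base change of Krull dimension, we transport the point instead (Steps 1–3):
1. `exists_finset_algebraicIndependent_maximal`: a maximal algebraically independent sub-family
   `P|_S` of the coordinates; every coordinate is algebraic over `ℚ[P|_S]`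
   (`AlgebraicIndependent.option_iff_transcendental`).
2. `card_le_zariskiDim_zeroLocus`: let `Ω` be an algebraic closure of `ℂ(t_S)`. The field
   `ℚ(P|_S) ≅ Frac ℚ[T_S]` embeds into `Ω` with `P_a ↦ t_a` (`AlgebraicIndependent.aevalEquiv`,
   `IsFractionRing.lift`), and this extends to `σ : ℚ(P) → Ω` (`IsAlgClosed.lift`, `ℚ(P)` being
   algebraic over `ℚ(P|_S)`). Since `σ` fixes the prime field, `Q = σ(P)` is an `Ω`-valued zero of
   the defining ideal `I`, so `Z(ker (aeval Q)) ⊆ Z(I) = W`; the prime `ker (aeval Q) ⊆ ℂ[X]` has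
   `zariskiDim Z(ker) = trdeg_ℂ ℂ[Q]` (`zariskiDim_zeroLocus_ker`, Nullstellensatz) and `ℂ[Q]`
   contains the algebraically independent `t_S`. Hence `#S ≤ zariskiDim ℂ W`.
3. `trdeg_adjoin_le_card`: `trdeg_ℚ ℚ(P) ≤ #S` (`Algebra.IsAlgebraic.trdeg_le_cardinalMk`; the
   algebraicity of `ℚ(P)` over `ℚ[P|_S]` is moved between `ℚ(P)` and `ℂ` with
   `IsAlgebraic.of_ringHom_of_comp_eq` and `IsFractionRing.isAlgebraic_iff`).

Everything is sorry-free over Mathlib and the tree (`ExpVarietiesDimension.lean`,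
`AffineDimension.lean`); no named fact is introduced. Standard material: Lang, *Algebra*, VIII §4
and IX §1 (transcendence bases; dimension of a variety = transcendence degree of its generic
point); Marker 2006 §1.

## References
* D. Marker, *A remark on Zilber's pseudoexponentiation*, J. Symbolic Logic 71 (2006), §1.
* H. Matsumura, *Commutative Ring Theory*, CUP 1986, Thm 5.6.
-/

namespace Literature.NumberTheory.Transcendental

open MvPolynomial Complex
open scoped IntermediateField.algebraAdjoinAdjoin

noncomputable section

variable {ι : Type} [Fintype ι]

/-- Step 1: a maximal algebraically independent sub-family of the coordinates of a point; every
coordinate is algebraic over the ℚ-algebra it generates. [folklore] -/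
theorem exists_finset_algebraicIndependent_maximal (P : ι → ℂ) :
    ∃ S : Finset ι, AlgebraicIndependent ℚ (fun i : S => P i) ∧
      ∀ j, IsAlgebraic (Algebra.adjoin ℚ (Set.range fun i : S => P i)) (P j) := by
  classical
  let good : Finset ι → Prop := fun S => AlgebraicIndependent ℚ (fun i : S => P i)
  have hgood0 : good ∅ := by
    haveI : IsEmpty {i // i ∈ (∅ : Finset ι)} := ⟨fun i => Finset.notMem_empty i.1 i.2⟩
    exact algebraicIndependent_empty_type_iff.mpr (algebraMap ℚ ℂ).injective
  have hne : ((Finset.univ : Finset (Finset ι)).filter good).Nonempty :=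
    ⟨∅, by simpa using hgood0⟩
  obtain ⟨S, hS, hmax⟩ := Finset.exists_max_image _ Finset.card hne
  simp only [Finset.mem_filter, Finset.mem_univ, true_and] at hS hmax
  refine ⟨S, hS, fun j => ?_⟩
  by_contra htr
  have hopt : AlgebraicIndependent ℚ (fun o : Option S => o.elim (P j) (fun i : S => P i)) :=
    (hS.option_iff_transcendental (P j)).mpr htr
  have hjS : j ∉ S := by
    intro hj
    exact htr (isAlgebraic_algebraMap
      (⟨P j, Algebra.subset_adjoin ⟨⟨j, hj⟩, rfl⟩⟩ : Algebra.adjoin ℚ (Set.range fun i : S => P i)))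
  let f : {i // i ∈ insert j S} → Option S := fun i =>
    if h : (i : ι) ∈ S then some ⟨i, h⟩ else none
  have hf_of_not : ∀ i : {i // i ∈ insert j S}, (i : ι) ∉ S → (i : ι) = j := fun i hi => by
    have := i.2
    rw [Finset.mem_insert] at this
    tauto
  have hf : Function.Injective f := by
    intro a b hab
    by_cases ha : (a : ι) ∈ S <;> by_cases hb : (b : ι) ∈ S
    · simp only [f, ha, hb, dif_pos, Option.some.injEq, Subtype.mk.injEq] at hab
      exact Subtype.ext hab
    · simp [f, ha, hb] at hab
    · simp [f, ha, hb] at hab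
    · exact Subtype.ext ((hf_of_not a ha).trans (hf_of_not b hb).symm)
  have hgood : good (insert j S) := by
    have hcomp := hopt.comp f hf
    have hfun : ((fun o : Option S => o.elim (P j) (fun i : S => P i)) ∘ f) =
        fun i : {i // i ∈ insert j S} => P i := by
      funext i
      by_cases h : (i : ι) ∈ S
      · simp [f, h]
      · simp [f, hf_of_not i h, hjS]
    simpa only [good, hfun] using hcomp
  have := hmax _ hgood
  rw [Finset.card_insert_of_notMem hjS] at this
  omega

/-- Step 2 (the transport): if `P ∈ Z(I)` for an ideal `I` of polynomials over the prime field and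
the coordinates `P|_S` are algebraically independent with every coordinate algebraic over them,
then `#S ≤ zariskiDim ℂ Z(I)`. [folklore] -/
theorem card_le_zariskiDim_zeroLocus (I : Ideal (MvPolynomial ι (⊥ : Subfield ℂ))) (P : ι → ℂ)
    (hP : P ∈ zeroLocus ℂ I) (S : Finset ι) (hS : AlgebraicIndependent ℚ (fun i : S => P i))
    (halg : ∀ j, IsAlgebraic (Algebra.adjoin ℚ (Set.range fun i : S => P i)) (P j)) :
    (S.card : WithBot ℕ∞) ≤ zariskiDim ℂ (zeroLocus ℂ I) := by
  classical
  -- the independent coordinates, the ℚ-algebra and the field they generate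
  set x : S → ℂ := fun i => P i with hx
  set T : Set ℂ := Set.range x with hT
  -- algebraic over `ℚ[P|_S]` ⇒ algebraic over `ℚ(P|_S)` (`IntermediateField.isAlgebraic_adjoin_iff`)
  have halgE₀ : ∀ j, IsAlgebraic (IntermediateField.adjoin ℚ T) (P j) := fun j =>
    IntermediateField.isAlgebraic_adjoin_iff.mpr (halg j)
  -- the big algebraically closed field `Ω ⊇ ℂ(t_S)`
  let L := FractionRing (MvPolynomial S ℂ)
  let Ω := AlgebraicClosure L
  let g : MvPolynomial S ℂ →ₐ[ℂ] Ω :=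
    (IsScalarTower.toAlgHom ℂ L Ω).comp (IsScalarTower.toAlgHom ℂ (MvPolynomial S ℂ) L)
  have hg : Function.Injective g :=
    (algebraMap L Ω).injective.comp (IsFractionRing.injective (MvPolynomial S ℂ) L)
  -- `σ₀ : ℚ(P|_S) → Ω`, `P a ↦ t_a` (through `ℚ[P|_S] ≅ ℚ[T_S] → ℂ[T_S] → Ω` and the fraction field)
  have hmapinj : Function.Injective (MvPolynomial.map (σ := S) (algebraMap ℚ ℂ)) :=
    MvPolynomial.map_injective _ (algebraMap ℚ ℂ).injective
  let R₀ : Subalgebra ℚ ℂ := Algebra.adjoin ℚ T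
  let E₀ : IntermediateField ℚ ℂ := IntermediateField.adjoin ℚ T
  let ψ₀ : R₀ →+* Ω :=
    g.toRingHom.comp ((MvPolynomial.map (algebraMap ℚ ℂ)).comp hS.aevalEquiv.symm.toAlgHom.toRingHom)
  have hψ₀ : Function.Injective ψ₀ := hg.comp (hmapinj.comp hS.aevalEquiv.symm.injective)
  let σ₀ : E₀ →+* Ω := IsFractionRing.lift (A := R₀) (K := E₀) hψ₀
  have hxmem : ∀ a : S, x a ∈ E₀ := fun a => IntermediateField.subset_adjoin _ _ ⟨a, rfl⟩
  have hxmemR : ∀ a : S, x a ∈ R₀ := fun a => Algebra.subset_adjoin ⟨a, rfl⟩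
  have hσ₀x : ∀ a : S, σ₀ ⟨x a, hxmem a⟩ = g (X a) := by
    intro a
    have h1 : hS.aevalEquiv.symm ⟨x a, hxmemR a⟩ = X a := by
      apply hS.aevalEquiv.injective
      rw [AlgEquiv.apply_symm_apply]
      apply Subtype.ext
      rw [AlgebraicIndependent.aevalEquiv_apply_coe, MvPolynomial.aeval_X]
    have h2 : (⟨x a, hxmem a⟩ : E₀) = algebraMap R₀ E₀ ⟨x a, hxmemR a⟩ := Subtype.ext rfl
    rw [h2, IsFractionRing.lift_algebraMap]
    simp only [ψ₀, RingHom.coe_comp, Function.comp_apply]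
    rw [show hS.aevalEquiv.symm.toAlgHom.toRingHom ⟨x a, hxmemR a⟩ =
      hS.aevalEquiv.symm ⟨x a, hxmemR a⟩ from rfl, h1, MvPolynomial.map_X]
    rfl
  -- extend `σ₀` to the field generated by all coordinates (algebraic over `E₀`)
  let E' : IntermediateField E₀ ℂ := IntermediateField.adjoin E₀ (Set.range P)
  haveI hE'alg : Algebra.IsAlgebraic E₀ E' := IntermediateField.isAlgebraic_adjoin fun y hy => by
    obtain ⟨j, rfl⟩ := hy
    exact (halgE₀ j).isIntegral
  letI : Algebra E₀ Ω := σ₀.toAlgebra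
  haveI : Module.IsTorsionFree E₀ E' := DivisionSemiring.to_moduleIsTorsionFree
  haveI : Module.IsTorsionFree E₀ Ω := DivisionSemiring.to_moduleIsTorsionFree
  let σ : E' →ₐ[E₀] Ω := IsAlgClosed.lift
  have hPmem : ∀ i, P i ∈ E' := fun i => IntermediateField.subset_adjoin _ _ ⟨i, rfl⟩
  let P' : ι → E' := fun i => ⟨P i, hPmem i⟩
  let Q : ι → Ω := fun i => σ (P' i)
  let φ : MvPolynomial ι ℂ →ₐ[ℂ] Ω := MvPolynomial.aeval Q
  -- `Q` extends `a ↦ t_a` on `S`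
  have hQx : ∀ a : S, Q a = g (X a) := by
    intro a
    have : P' a = algebraMap E₀ E' ⟨x a, hxmem a⟩ := Subtype.ext rfl
    simp only [Q, this, AlgHom.commutes]
    exact hσ₀x a
  -- hence `trdeg_ℂ (range φ) ≥ #S`
  have hmem : ∀ a : S, g (X a) ∈ φ.range := fun a =>
    ⟨X (a : ι), by simp only [φ, AlgHom.toRingHom_eq_coe, AlgHom.coe_toRingHom, MvPolynomial.aeval_X, hQx]⟩
  have hind : AlgebraicIndependent ℂ (fun a : S => (⟨g (X a), hmem a⟩ : φ.range)) := by
    apply AlgebraicIndependent.of_comp φ.range.val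
    have hc : (φ.range.val ∘ fun a : S => (⟨g (X a), hmem a⟩ : φ.range)) = g ∘ X := rfl
    rw [hc, algebraicIndependent_iff_injective_aeval]
    have : MvPolynomial.aeval (g ∘ X : S → Ω) = g := by
      refine MvPolynomial.algHom_ext fun a => ?_
      simp
    rw [this]
    exact hg
  have hcard : Cardinal.mk S ≤ Algebra.trdeg ℂ φ.range := hind.cardinalMk_le_trdeg
  have hfin : Algebra.trdeg ℂ φ.range < Cardinal.aleph0 := by
    refine lt_of_le_of_lt (trdeg_le_of_surjective φ.rangeRestrict φ.rangeRestrict_surjective) ?_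
    rw [MvPolynomial.trdeg_of_isDomain]
    simp
  have hnat : S.card ≤ Cardinal.toNat (Algebra.trdeg ℂ φ.range) := by
    simpa using Cardinal.toNat_le_toNat hcard hfin
  -- `σ` fixes the prime field, so `φ` kills `I`
  have hbotmem : ∀ c : (⊥ : Subfield ℂ), (c : ℂ) ∈ E' := fun c =>
    (bot_le (a := E'.toSubfield)) c.2
  let ρ : (⊥ : Subfield ℂ) →+* E' :=
    { toFun := fun c => ⟨c, hbotmem c⟩
      map_one' := rfl
      map_mul' := fun _ _ => rfl
      map_zero' := rfl
      map_add' := fun _ _ => rfl }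
  have hρbot : ∀ c : (⊥ : Subfield ℂ), ρ c ∈ (⊥ : Subfield E') := by
    intro c
    have h1 : (⊥ : Subfield E').map (algebraMap E' ℂ) = ⊥ := by
      rw [← Subfield.closure_empty, RingHom.map_field_closure, Set.image_empty,
        Subfield.closure_empty]
    have h2 : (c : ℂ) ∈ (⊥ : Subfield E').map (algebraMap E' ℂ) := by rw [h1]; exact c.2
    obtain ⟨c', hc', hcc'⟩ := Subfield.mem_map.1 h2
    have : c' = ρ c := Subtype.ext hcc'
    rwa [this] at hc'
  have hσρ : ∀ c, σ (ρ c) = algebraMap ℂ Ω c := by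
    intro c
    have heq : Set.EqOn σ.toRingHom ((algebraMap ℂ Ω).comp (algebraMap E' ℂ))
        (Subfield.closure (∅ : Set E')) :=
      RingHom.eqOn_field_closure (by simp [Set.EqOn])
    rw [Subfield.closure_empty] at heq
    exact heq (hρbot c)
  have hcompρ : σ.toRingHom.comp ρ = (algebraMap ℂ Ω).comp (algebraMap (⊥ : Subfield ℂ) ℂ) :=
    RingHom.ext fun c => hσρ c
  have hφI : ∀ f ∈ I, φ (MvPolynomial.map (algebraMap (⊥ : Subfield ℂ) ℂ) f) = 0 := by
    intro f hf
    have h0 : MvPolynomial.aeval P f = 0 := hP f hf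
    have h1 : (algebraMap E' ℂ) (MvPolynomial.eval₂ ρ P' f) = MvPolynomial.aeval P f := by
      rw [MvPolynomial.eval₂_comp_left]
      rfl
    have h2 : MvPolynomial.eval₂ ρ P' f = 0 := by
      apply (algebraMap E' ℂ).injective
      rw [h1, h0, map_zero]
    have h3 : φ (MvPolynomial.map (algebraMap (⊥ : Subfield ℂ) ℂ) f) =
        MvPolynomial.eval₂ ((algebraMap ℂ Ω).comp (algebraMap (⊥ : Subfield ℂ) ℂ)) Q f := by
      simp only [φ, MvPolynomial.aeval_def, MvPolynomial.eval₂_map]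
    have h4 : σ (MvPolynomial.eval₂ ρ P' f) = MvPolynomial.eval₂ (σ.toRingHom.comp ρ) (σ ∘ P') f :=
      MvPolynomial.eval₂_comp_left _ _ _ _
    rw [h3, ← hcompρ, show (Q : ι → Ω) = σ ∘ P' from rfl, ← h4, h2, map_zero]
  have hsub : zeroLocus ℂ (RingHom.ker φ.toRingHom) ⊆ zeroLocus ℂ I := by
    intro z hz f hf
    have hmemK : MvPolynomial.map (algebraMap (⊥ : Subfield ℂ) ℂ) f ∈ RingHom.ker φ.toRingHom := by
      rw [RingHom.mem_ker]
      exact hφI f hf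
    have := hz _ hmemK
    rwa [MvPolynomial.aeval_map_algebraMap] at this
  -- assemble
  have hdimZ := zariskiDim_zeroLocus_ker φ
  calc (S.card : WithBot ℕ∞) ≤ (Cardinal.toNat (Algebra.trdeg ℂ φ.range) : WithBot ℕ∞) := by
        exact_mod_cast hnat
    _ = zariskiDim ℂ (zeroLocus ℂ (RingHom.ker φ)) := hdimZ.symm
    _ ≤ zariskiDim ℂ (zeroLocus ℂ I) := zariskiDim_mono hsub

omit [Fintype ι] in
/-- Step 3: with `S` as in Step 1, `trdeg_ℚ ℚ(P) ≤ #S` (the coordinates `P|_S` span the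
transcendence matroid of `ℚ(P)`). [folklore] -/
theorem trdeg_adjoin_le_card (P : ι → ℂ) (S : Finset ι)
    (halg : ∀ j, IsAlgebraic (Algebra.adjoin ℚ (Set.range fun i : S => P i)) (P j)) :
    Algebra.trdeg ℚ (IntermediateField.adjoin ℚ (Set.range P)) ≤ S.card := by
  classical
  set x : S → ℂ := fun i => P i with hx
  set T : Set ℂ := Set.range x with hT
  let R₀ : Subalgebra ℚ ℂ := Algebra.adjoin ℚ T
  let E₀ : IntermediateField ℚ ℂ := IntermediateField.adjoin ℚ T
  let E : IntermediateField ℚ ℂ := IntermediateField.adjoin ℚ (Set.range P)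
  have halgE₀ : ∀ j, IsAlgebraic E₀ (P j) := fun j =>
    IntermediateField.isAlgebraic_adjoin_iff.mpr (halg j)
  -- every element of `E = ℚ(P)` is algebraic over `E₀ = ℚ(P|_S)`, hence over `R₀ = ℚ[P|_S]`
  have hEle : E ≤ (algebraicClosure E₀ ℂ).restrictScalars ℚ := by
    refine IntermediateField.adjoin_le_iff.mpr ?_
    rintro _ ⟨j, rfl⟩
    exact mem_algebraicClosure_iff.mpr (halgE₀ j)
  have halgR₀ : ∀ e : E, IsAlgebraic R₀ (e : ℂ) := fun e =>
    (IsFractionRing.isAlgebraic_iff R₀ E₀ ℂ).mpr (mem_algebraicClosure_iff.mp (hEle e.2))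
  -- the `S`-coordinates inside `E`
  have hmemE : ∀ i, P i ∈ E := fun i => IntermediateField.subset_adjoin _ _ ⟨i, rfl⟩
  let y : S → E := fun a => ⟨P a, hmemE a⟩
  let sE : Set E := Set.range y
  -- `ℚ[sE] ≅ R₀` along the inclusion `E ⊆ ℂ` (as a ℚ-algebra map for the default ℚ-structures)
  let v : E →ₐ[ℚ] ℂ := (algebraMap E ℂ).toRatAlgHom
  have hvinj : Function.Injective v := (algebraMap E ℂ).injective
  have himage : (v : E → ℂ) '' sE = T := by
    apply Set.Subset.antisymm
    · rintro _ ⟨_, ⟨a, rfl⟩, rfl⟩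
      exact ⟨a, rfl⟩
    · rintro _ ⟨a, rfl⟩
      exact ⟨y a, ⟨a, rfl⟩, rfl⟩
  have hmap : (Algebra.adjoin ℚ sE).map v = R₀ := by
    rw [AlgHom.map_adjoin, himage]
  let e₁ : Algebra.adjoin ℚ sE ≃ₐ[ℚ] R₀ :=
    (Subalgebra.equivMapOfInjective _ v hvinj).trans (Subalgebra.equivOfEq _ _ hmap)
  have he₁ : ∀ r : Algebra.adjoin ℚ sE, ((e₁ r : R₀) : ℂ) = ((r : E) : ℂ) := fun r => by
    have h := Subalgebra.coe_equivMapOfInjective_apply (Algebra.adjoin ℚ sE) v hvinj r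
    simp only [e₁, AlgEquiv.trans_apply, Subalgebra.equivOfEq_apply]
    rw [h]
    rfl
  haveI : Algebra.IsAlgebraic (Algebra.adjoin ℚ sE) E := by
    refine ⟨fun e => ?_⟩
    refine IsAlgebraic.of_ringHom_of_comp_eq (f := e₁.toAlgHom.toRingHom) (g := algebraMap E ℂ)
      (halgR₀ e) e₁.surjective (algebraMap E ℂ).injective ?_
    ext r
    exact he₁ r
  calc Algebra.trdeg ℚ E ≤ Cardinal.mk sE := Algebra.IsAlgebraic.trdeg_le_cardinalMk ℚ sE
    _ ≤ Cardinal.mk S := Cardinal.mk_range_le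
    _ = S.card := Cardinal.mk_coe_finset

/-- **The transcendence degree of a point is at most the dimension of any ℚ-variety through it**:
if `P ∈ W ⊆ ℂ^ι` with `W` defined over the prime field and `zariskiDim ℂ W < d`, then
`trdeg_ℚ ℚ(P) < d`. (Proof: pick a transcendence basis `P|_S` among the coordinates; embed
`ℚ(P)` into an algebraically closed field `Ω ⊇ ℂ(t_S)` sending `P|_S` to the indeterminates
`t_S` (`IsAlgClosed.lift`); the image `Q` of `P` is an `Ω`-point of `W` whose coordinates have
`trdeg_ℂ ≥ #S`, so the prime `ker (aeval Q) ⊇ I·ℂ[X]` has `zariskiDim Z(ker) = trdeg_ℂ ℂ[Q] ≥ #S`.)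
[folklore] -/
theorem trdeg_adjoin_lt_of_mem_of_zariskiDim_lt {W : Set (ι → ℂ)}
    (hW : IsDefinedOver (⊥ : Subfield ℂ) W) {P : ι → ℂ} (hP : P ∈ W) {d : ℕ}
    (hdim : zariskiDim ℂ W < d) :
    Algebra.trdeg ℚ (IntermediateField.adjoin ℚ (Set.range P)) < d := by
  classical
  obtain ⟨I, rfl⟩ := hW
  obtain ⟨S, hS, halg⟩ := exists_finset_algebraicIndependent_maximal P
  have h1 := card_le_zariskiDim_zeroLocus I P hP S hS halg
  have h2 := trdeg_adjoin_le_card P S halg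
  have h3 : S.card < d := by
    have : (S.card : WithBot ℕ∞) < d := lt_of_le_of_lt h1 hdim
    exact_mod_cast this
  exact lt_of_le_of_lt h2 (by exact_mod_cast h3)

/-- **Schanuel at `n = 2` empties `indepExpPoints W`** for every `W ⊆ ℂ² × ℂ²` defined over ℚ
with `zariskiDim ℂ W < 2`: a ℚ-independent graph point `(x, eˣ) ∈ W` would have
`trdeg_ℚ ℚ(x, eˣ) < 2`. The hypothesis is `SchanuelRank 2` (Roy's format, `RoyCriterion.lean`),
the `n = 2` slice of `Literature.Periods.SchanuelConjecture`. [folklore] -/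
theorem indepExpPoints_eq_empty_of_schanuelRank_two (hSC : SchanuelRank 2)
    {W : Set (Fin 2 ⊕ Fin 2 → ℂ)} (hW : IsDefinedOver (⊥ : Subfield ℂ) W)
    (hdim : zariskiDim ℂ W < 2) : indepExpPoints W = ∅ := by
  ext x
  simp only [Set.mem_empty_iff_false, iff_false]
  rintro ⟨hx, hxW⟩
  have h1 := trdeg_adjoin_lt_of_mem_of_zariskiDim_lt (d := 2) hW hxW (by exact_mod_cast hdim)
  rw [Set.Sum.elim_range] at h1
  exact absurd (hSC x hx) (not_le.mpr h1)

/-- Hence **Schanuel at `n = 2` implies sparsity at `n = 2`** (indeed with `∅` for "finite"):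
the crux `SparsityTwo` of the Schanuel routes is a theorem of SC(2), so it admits no
unconditional refutation. [folklore] -/
theorem sparsity_of_schanuelRank_two (hSC : SchanuelRank 2)
    (W : Set (Fin 2 ⊕ Fin 2 → ℂ)) (hW : IsDefinedOver (⊥ : Subfield ℂ) W)
    (hdim : zariskiDim ℂ W < 2) : (indepExpPoints W).Finite := by
  rw [indepExpPoints_eq_empty_of_schanuelRank_two hSC hW hdim]
  exact Set.finite_empty


end

end Literature.NumberTheory.Transcendental
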